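import Summits.CriticalPhenomena.PercolationContinuityZ3.Theorems.PercNearOneGluingNoHeavyLowerTailStarSetTwoPortChampion
import HarnessLib

/-!
# `NoHeavyLowerTail` (stmt-CriticalPhenomena-4575) — observer sets of ONE-port pendants and TWO-port stars (ANY port multigraph), level `j ≤ 2`

Support file (prover `prim-gen-swap` gen 16; `--supports stmt-CriticalPhenomena-4575`).  No definitions, no named facts, no sorries.

The unrestricted analogue of …StarSetPendantForest / …StarSetClassPendantForest: `StarSet.setCS_twoPortStarMultigraph_levelTwo_champion`
(EVERY two-port star multigraph, champion witness) plus relay-pendant members, stripped one by one with `CutObserver.setCS_of_pendantMember`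
(`StarSet.lightness_eq_off_pendant`).  The end result is the cell's final observer theorem: CIL at level `j ≤ 2` holds, with ANY
`H`-champion as witness, at every observer all of whose Steiner neighbours have relay-degree `≤ 2` and no other positive pair.

* `StarSet.setCS_twoPortStarMultigraphSet_levelTwo_champion` — finset form of the champion theorem: `CS_w(B, c)` for any finset `B` of
  two-port pendant stars (no `hdis`, no peeling order), `c` a champion.
* `StarSet.setCS_pendants_twoPortStarMultigraph_champion` — `CS_w(T ∪ S, c)` for any finset `T` of relay-pendants and ANY system `S` of
  two-port pendant stars, `c` a champion (induction on `T`).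
* `StarSet.cil_pendants_twoPortStarMultigraph_champion` — **CIL_j (`j ≤ 2`, all `|A|`) at every observer `o ∉ A` each of whose
  positive-weight non-relay neighbours is, off `o`, either a relay-pendant or a two-port pendant star (no hypothesis on the port
  multigraph); witness ANY `H`-champion `q ∈ A`.**
-/

noncomputable section

namespace Summit.CriticalPhenomena.PercolationContinuityZ3.Theorems

open MeasureTheory Set Literature.Probability.LatticeModels Literature.Probability.Percolation
open scoped Classical BigOperators

variable {n : ℕ}

namespace StarSet

/-- **OES at level `j ≤ 2` for a FINSET of two-port pendant stars (any port multigraph), champion witness (port or not).**  `B` a finset of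
non-relays `y ∉ A` with ports `p y ≠ p' y ∈ A` and no other positive pair, `c` a champion of `A`.  Then `CS_w(B, c)`:
`μ(c ↮ B, 1 ≤ |π(B)| ≤ j) ≤ μ(c ↮ B, |π(c)| ≤ j)` — the hypothesis `hdis` of `setCS_twoPortStarSet_levelTwo_champion` (distinct ports)
and the peeling order of `setCS_twoPortStarForestSet_levelTwo_champion` (forest port graph) are gone.
[cite: VandenbergHaggstromKahn2005, Thm. 1.5 (p. 7) — via `StarSet.setCS_twoPortStarMultigraph_levelTwo_champion`] -/
theorem setCS_twoPortStarMultigraphSet_levelTwo_champion (w : Sym2 (Fin n) → unitInterval) (A B : Finset (Fin n))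
    (p p' : Fin n → Fin n) (c : Fin n) (j : ℕ) (hj : j ≤ 2) (hBA : ∀ y ∈ B, y ∉ A)
    (hports : ∀ y ∈ B, p y ∈ A ∧ p' y ∈ A ∧ p y ≠ p' y)
    (hobs : ∀ y ∈ B, ∀ u : Fin n, u ≠ y → w s(y, u) ≠ 0 → u = p y ∨ u = p' y)
    (hcA : c ∈ A)
    (hchamp : ∀ a ∈ A, (prodBernoulli w).real {ω : BondConfig (Fin n) | (A.filter fun z => ω ∈ openConn a z).card ≤ j} ≤
      (prodBernoulli w).real {ω : BondConfig (Fin n) | (A.filter fun z => ω ∈ openConn c z).card ≤ j}) :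
    (prodBernoulli w).real {ω : BondConfig (Fin n) | (∀ y ∈ B, ω ∉ openConn c y) ∧
        1 ≤ (A.filter fun z => ∃ y ∈ B, ω ∈ openConn y z).card ∧
        (A.filter fun z => ∃ y ∈ B, ω ∈ openConn y z).card ≤ j} ≤
      (prodBernoulli w).real {ω : BondConfig (Fin n) | (∀ y ∈ B, ω ∉ openConn c y) ∧
        (A.filter fun z => ω ∈ openConn c z).card ≤ j} := by
  -- enumerate the stars
  set emb := B.orderEmbOfFin rfl with hemb
  set s : Fin B.card → Fin n := fun k => emb k with hs_def
  have hsB : ∀ k, s k ∈ B := fun k => Finset.orderEmbOfFin_mem B rfl k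
  have hs : Function.Injective s := fun k k' h => emb.injective h
  have hSB : Finset.univ.image s = B := by
    ext x
    rw [Finset.mem_image]
    constructor
    · rintro ⟨k, -, rfl⟩; exact hsB k
    · intro hx
      have hrange := Finset.range_orderEmbOfFin B rfl
      have hx' : x ∈ Set.range emb := by rw [hemb, hrange]; exact hx
      obtain ⟨k, hk⟩ := hx'
      exact ⟨k, Finset.mem_univ _, by simp only [hs_def, hk]⟩
  have h := setCS_twoPortStarMultigraph_levelTwo_champion A c j hj hcA B.card w s (fun k => p (s k)) (fun k => p' (s k)) hs
    (fun k => hBA _ (hsB k)) (fun k => (hports _ (hsB k)).1) (fun k => (hports _ (hsB k)).2.1) (fun k => (hports _ (hsB k)).2.2)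
    (fun k u hu hup hup' => by
      by_contra hne
      rcases hobs _ (hsB k) u hu hne with h | h
      · exact hup h
      · exact hup' h)
    hchamp
  rw [hSB] at h
  exact h

open CutObserver KNPreFKG Hyperedge in
/-- **OES for relay-pendants plus ANY two-port star multigraph, champion witness.**  `T` a finset of relay-pendants (`t ∉ A`, only positive
pair to `z t ∈ A`), `S = {s i}` a system of two-port pendant stars as in `setCS_twoPortStarMultigraph_levelTwo_champion` (ports
`p i ≠ p' i ∈ A`, arbitrary port multigraph), `T` and `S` disjoint, `c` a champion of `A`, `j ≤ 2`.  Then `CS_w(T ∪ S, c)`.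
[cite: VandenbergHaggstromKahn2005, Thm. 1.5 (p. 7)] -/
theorem setCS_pendants_twoPortStarMultigraph_champion (A : Finset (Fin n)) (c : Fin n) (j : ℕ) (hj : j ≤ 2) (hcA : c ∈ A)
    {m : ℕ} (s p p' : Fin m → Fin n) (z : Fin n → Fin n) (hs : Function.Injective s) (hsA : ∀ i, s i ∉ A)
    (hpA : ∀ i, p i ∈ A) (hp'A : ∀ i, p' i ∈ A) (hpp' : ∀ i, p i ≠ p' i) (T : Finset (Fin n)) :
    ∀ (w : Sym2 (Fin n) → unitInterval),
      (∀ t ∈ T, t ∉ A ∧ z t ∈ A ∧ (∀ i, t ≠ s i) ∧ ∀ u : Fin n, u ≠ t → u ≠ z t → w s(t, u) = 0) →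
      (∀ i (u : Fin n), u ≠ s i → u ≠ p i → u ≠ p' i → w s(s i, u) = 0) →
      (∀ a ∈ A, (prodBernoulli w).real {ω : BondConfig (Fin n) | (A.filter fun x => ω ∈ openConn a x).card ≤ j} ≤
        (prodBernoulli w).real {ω : BondConfig (Fin n) | (A.filter fun x => ω ∈ openConn c x).card ≤ j}) →
      (prodBernoulli w).real {ω : BondConfig (Fin n) | (∀ x ∈ T ∪ Finset.univ.image s, ω ∉ openConn c x) ∧
          1 ≤ (A.filter fun a => ∃ x ∈ T ∪ Finset.univ.image s, ω ∈ openConn x a).card ∧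
          (A.filter fun a => ∃ x ∈ T ∪ Finset.univ.image s, ω ∈ openConn x a).card ≤ j} ≤
        (prodBernoulli w).real {ω : BondConfig (Fin n) | (∀ x ∈ T ∪ Finset.univ.image s, ω ∉ openConn c x) ∧
          (A.filter fun a => ω ∈ openConn c a).card ≤ j} := by
  induction T using Finset.induction_on with
  | empty =>
    intro w _ hobs hchamp
    rw [Finset.empty_union]
    exact setCS_twoPortStarMultigraph_levelTwo_champion A c j hj hcA m w s p p' hs hsA hpA hp'A hpp' hobs hchamp
  | insert t T₀ ht ih =>
    intro w hT hobs hchamp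
    obtain ⟨htA, hztA, hts, hiso⟩ := hT t (Finset.mem_insert_self t T₀)
    have hzt : z t ≠ t := fun h => htA (h ▸ hztA)
    have hct : c ≠ t := fun h => htA (h ▸ hcA)
    set B : Finset (Fin n) := insert t T₀ ∪ Finset.univ.image s with hB
    have htB : t ∈ B := Finset.mem_union_left _ (Finset.mem_insert_self t T₀)
    set w' : Sym2 (Fin n) → unitInterval := fun f => if f ∈ {f : Sym2 (Fin n) | t ∉ f} then w f else 0 with hw'
    -- lightnesses of relays are unchanged
    have hlight : ∀ x ∈ A, ∀ d ∈ A, d ≠ z t →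
        (prodBernoulli w).real {ω : BondConfig (Fin n) | (A.filter fun a => ω ∈ openConn x a).card ≤ j} =
          (prodBernoulli w').real {ω : BondConfig (Fin n) | (A.filter fun a => ω ∈ openConn x a).card ≤ j} :=
      fun x hx d hd hdz => lightness_eq_off_pendant w A t (z t) d x j htA hzt hd hdz hx hiso
    have hchamp' : ∀ a ∈ A, (prodBernoulli w').real {ω : BondConfig (Fin n) | (A.filter fun x => ω ∈ openConn a x).card ≤ j} ≤
        (prodBernoulli w').real {ω : BondConfig (Fin n) | (A.filter fun x => ω ∈ openConn c x).card ≤ j} := by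
      intro a ha
      by_cases hac : a = c
      · rw [hac]
      -- a witness `d ∈ A` off `z t`: one of `a`, `c`
      obtain ⟨d, hd, hdz⟩ : ∃ d ∈ A, d ≠ z t := by
        by_cases haz : a = z t
        · exact ⟨c, hcA, fun h => hac (haz.trans h.symm)⟩
        · exact ⟨a, ha, haz⟩
      rw [← hlight a ha d hd hdz, ← hlight c hcA d hd hdz]
      exact hchamp a ha
    have hw'_off : ∀ y u : Fin n, y ≠ t → u ≠ t → w' s(y, u) = w s(y, u) := by
      intro y u hy hu
      have hf : t ∉ s(y, u) := by
        intro h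
        rcases Sym2.mem_iff.1 h with h | h
        · exact hy h.symm
        · exact hu h.symm
      simp only [hw', mem_setOf_eq, hf, not_false_eq_true, if_true]
    have hw'_t : ∀ y : Fin n, w' s(y, t) = 0 := by
      intro y
      have : ¬ (t ∉ s(y, t)) := fun h => h (Sym2.mem_mk_right _ _)
      simp only [hw', mem_setOf_eq, this, if_false]
    -- the rest of the set in the graph off `t`
    have hrest := ih w'
      (fun t' ht' => by
        obtain ⟨h1, h2, h3, h4⟩ := hT t' (Finset.mem_insert_of_mem ht')
        have htt' : t' ≠ t := fun h => ht (h ▸ ht')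
        refine ⟨h1, h2, h3, fun u hu huz => ?_⟩
        by_cases hut : u = t
        · rw [hut]; exact hw'_t t'
        · rw [hw'_off t' u htt' hut]; exact h4 u hu huz)
      (fun i u hu hup hup' => by
        by_cases hut : u = t
        · rw [hut]; exact hw'_t _
        · rw [hw'_off _ u (fun h => hts i h.symm) hut]; exact hobs i u hu hup hup')
      hchamp'
    have hBerase : B.erase t = T₀ ∪ Finset.univ.image s := by
      ext x
      rw [Finset.mem_erase, hB, Finset.mem_union, Finset.mem_union, Finset.mem_insert]
      constructor
      · rintro ⟨hne, (h | h) | h⟩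
        · exact absurd h hne
        · exact Or.inl h
        · exact Or.inr h
      · rintro (h | h)
        · exact ⟨fun hx => ht (hx ▸ h), Or.inl (Or.inr h)⟩
        · refine ⟨fun hx => ?_, Or.inr h⟩
          obtain ⟨i, -, hi⟩ := Finset.mem_image.1 h
          exact hts i (hx ▸ hi.symm)
    rw [← hBerase] at hrest
    have hdom : (prodBernoulli w').real {ω : BondConfig (Fin n) | (A.filter fun a => ω ∈ openConn (z t) a).card ≤ j} ≤
        (prodBernoulli w').real {ω : BondConfig (Fin n) | (A.filter fun a => ω ∈ openConn c a).card ≤ j} := hchamp' (z t) hztA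
    exact setCS_of_pendantMember w A B c t (z t) j htB htA hzt hct hiso hdom hrest

open CutObserver in
/-- **CIL at level `j ≤ 2`: Steiner neighbours that are relay-pendants or two-port pendant stars (ANY port multigraph), any `H`-champion.**
`o ∉ A`; every positive-weight non-relay neighbour of `o` is, off `o`, either one of the two-port stars `s i` (ports `p i ≠ p' i ∈ A`,
no restriction on the port multigraph) or a relay-pendant `t ∈ P` (only positive pair off `o` to `z t ∈ A`); `q ∈ A` an `H`-champion.
Then `μ(1 ≤ |π(o)| ≤ j) ≤ μ(|π(q)| ≤ j)`. [cite: VandenbergHaggstromKahn2005, Thm. 1.5 (p. 7); KozmaNitzan2024, Thm. 4 (pp. 13–14)] -/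
theorem cil_pendants_twoPortStarMultigraph_champion {Ms : ℕ} (w : Sym2 (Fin n) → unitInterval) (A : Finset (Fin n)) (o q : Fin n)
    (s p p' : Fin Ms → Fin n) (P : Finset (Fin n)) (z : Fin n → Fin n) (j : ℕ) (hj : j ≤ 2) (hoA : o ∉ A) (hqA : q ∈ A)
    (hs : Function.Injective s) (hso : ∀ i, s i ≠ o) (hsA : ∀ i, s i ∉ A) (hpA : ∀ i, p i ∈ A) (hp'A : ∀ i, p' i ∈ A)
    (hpp' : ∀ i, p i ≠ p' i)
    (hP : ∀ t ∈ P, t ≠ o ∧ t ∉ A ∧ z t ∈ A ∧ (∀ i, t ≠ s i) ∧ ∀ u : Fin n, u ≠ t → u ≠ o → u ≠ z t → w s(t, u) = 0)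
    (hnbr : ∀ y : Fin n, y ≠ o → y ∉ A → w s(o, y) ≠ 0 → y ∈ P ∨ ∃ i, y = s i)
    (hobs : ∀ i (u : Fin n), u ≠ s i → u ≠ o → u ≠ p i → u ≠ p' i → w s(s i, u) = 0)
    (hchamp : ∀ a ∈ A,
      (prodBernoulli w).real {ω : BondConfig (Fin n) |
          (A.filter fun x => (openGraph (ω ∩ {e | o ∉ e})).Reachable a x).card ≤ j} ≤
        (prodBernoulli w).real {ω : BondConfig (Fin n) |
          (A.filter fun x => (openGraph (ω ∩ {e | o ∉ e})).Reachable q x).card ≤ j}) :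
    (prodBernoulli w).real {ω : BondConfig (Fin n) |
        1 ≤ (A.filter fun x => ω ∈ openConn o x).card ∧ (A.filter fun x => ω ∈ openConn o x).card ≤ j} ≤
      (prodBernoulli w).real {ω : BondConfig (Fin n) | (A.filter fun x => ω ∈ openConn q x).card ≤ j} := by
  have hqo : q ≠ o := fun h => hoA (h ▸ hqA)
  refine cil_of_starStability w A o q j hoA hqo fun B hBne hB => ?_
  set u : Sym2 (Fin n) → unitInterval := fun e => if e ∈ {e : Sym2 (Fin n) | o ∉ e} then w e else 0 with hu
  have hmem : ∀ y ∈ B, y ≠ o ∧ y ∉ A ∧ w s(o, y) ≠ 0 := by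
    intro y hy
    obtain ⟨hyo, hwy, hlt⟩ := hB y hy
    refine ⟨hyo, fun hyA => ?_, hwy⟩
    exact absurd (hchamp y hyA) (not_le.2 hlt)
  have e1 : ∀ x : Fin n, {ω : BondConfig (Fin n) |
        (A.filter fun a => (openGraph (ω ∩ {e | o ∉ e})).Reachable x a).card ≤ j} =
      {ω : BondConfig (Fin n) | ω ∩ {e | o ∉ e} ∈
        {ξ : BondConfig (Fin n) | (A.filter fun a => ξ ∈ openConn x a).card ≤ j}} := by
    intro x; ext ω; simp only [mem_setOf_eq, filter_avoid_eq]
  have hdomH : ∀ x ∈ A, (prodBernoulli u).real {ξ : BondConfig (Fin n) | (A.filter fun a => ξ ∈ openConn x a).card ≤ j} ≤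
      (prodBernoulli u).real {ξ : BondConfig (Fin n) | (A.filter fun a => ξ ∈ openConn q a).card ≤ j} := by
    intro x hx
    have h := hchamp x hx
    rw [e1 x, e1 q, measureReal_preimage_avoid, measureReal_preimage_avoid] at h
    exact h
  have e2 : {ω : BondConfig (Fin n) |
        (∀ y ∈ B, ¬ (openGraph (ω ∩ {e | o ∉ e})).Reachable q y) ∧
          1 ≤ (A.filter fun a => ∃ y ∈ B, (openGraph (ω ∩ {e | o ∉ e})).Reachable y a).card ∧
          (A.filter fun a => ∃ y ∈ B, (openGraph (ω ∩ {e | o ∉ e})).Reachable y a).card ≤ j} =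
      {ω : BondConfig (Fin n) | ω ∩ {e | o ∉ e} ∈
        {ξ : BondConfig (Fin n) | (∀ x ∈ B, ξ ∉ openConn q x) ∧
          1 ≤ (A.filter fun a => ∃ x ∈ B, ξ ∈ openConn x a).card ∧
          (A.filter fun a => ∃ x ∈ B, ξ ∈ openConn x a).card ≤ j}} := by
    ext ω; simp only [mem_setOf_eq, filter_avoid_exists_eq]; exact Iff.rfl
  have e3 : {ω : BondConfig (Fin n) |
        (∀ y ∈ B, ¬ (openGraph (ω ∩ {e | o ∉ e})).Reachable q y) ∧
          (A.filter fun a => (openGraph (ω ∩ {e | o ∉ e})).Reachable q a).card ≤ j} =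
      {ω : BondConfig (Fin n) | ω ∩ {e | o ∉ e} ∈
        {ξ : BondConfig (Fin n) | (∀ x ∈ B, ξ ∉ openConn q x) ∧
          (A.filter fun a => ξ ∈ openConn q a).card ≤ j}} := by
    ext ω; simp only [mem_setOf_eq, filter_avoid_eq]; exact Iff.rfl
  rw [e2, e3, measureReal_preimage_avoid, measureReal_preimage_avoid]
  have hu_oy : ∀ y v : Fin n, v = o → u s(y, v) = 0 := by
    intro y v hv
    simp only [hu, mem_setOf_eq]
    rw [if_neg (fun h => h (hv ▸ Sym2.mem_mk_right y v))]
  have hu_off : ∀ y v : Fin n, y ≠ o → v ≠ o → u s(y, v) = w s(y, v) := by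
    intro y v hy hv
    simp only [hu, mem_setOf_eq]
    rw [if_pos]
    intro h
    rcases Sym2.mem_iff.1 h with h | h
    · exact hy h.symm
    · exact hv h.symm
  -- the stars in `B` and the pendants in `B`
  set I : Finset (Fin Ms) := Finset.univ.filter fun i => s i ∈ B with hI
  set emb := I.orderEmbOfFin rfl with hemb
  set s' : Fin I.card → Fin n := fun k => s (emb k) with hs'
  set T : Finset (Fin n) := B.filter fun y => y ∈ P with hT
  have hembI : ∀ k, emb k ∈ I := fun k => Finset.orderEmbOfFin_mem I rfl k
  have hs'B : ∀ k, s' k ∈ B := fun k => (Finset.mem_filter.1 (hembI k)).2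
  have hs'inj : Function.Injective s' := fun k k' h => emb.injective (hs h)
  have hTS : T ∪ Finset.univ.image s' = B := by
    ext y
    rw [Finset.mem_union, hT, Finset.mem_filter, Finset.mem_image]
    constructor
    · rintro (⟨hy, -⟩ | ⟨k, -, rfl⟩)
      · exact hy
      · exact hs'B k
    · intro hy
      obtain ⟨hyo, hyA, hwy⟩ := hmem y hy
      rcases hnbr y hyo hyA hwy with hyP | ⟨i, rfl⟩
      · exact Or.inl ⟨hy, hyP⟩
      · have hiI : i ∈ I := Finset.mem_filter.2 ⟨Finset.mem_univ _, hy⟩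
        have hrange := Finset.range_orderEmbOfFin I rfl
        have hi' : i ∈ Set.range emb := by rw [hemb, hrange]; exact hiI
        obtain ⟨k, hk⟩ := hi'
        exact Or.inr ⟨k, Finset.mem_univ _, by simp only [hs', hk]⟩
  have h := setCS_pendants_twoPortStarMultigraph_champion A q j hj hqA s' (fun k => p (emb k)) (fun k => p' (emb k)) z hs'inj
    (fun k => hsA _) (fun k => hpA _) (fun k => hp'A _) (fun k => hpp' _) T u
    (fun t ht => by
      obtain ⟨htB, htP⟩ := Finset.mem_filter.1 ht
      obtain ⟨hto, htA, hztA, hts, hiso⟩ := hP t htP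
      refine ⟨htA, hztA, fun k => hts _, fun v hv hvz => ?_⟩
      by_cases hvo : v = o
      · exact hu_oy t v hvo
      · rw [hu_off t v hto hvo]; exact hiso v hv hvo hvz)
    (fun k v hv hvp hvp' => by
      by_cases hvo : v = o
      · exact hu_oy _ v hvo
      · rw [hs', hu_off _ v (hso _) hvo]
        exact hobs (emb k) v hv hvo hvp hvp')
    hdomH
  rw [hTS] at h
  exact h

end StarSet

end Summit.CriticalPhenomena.PercolationContinuityZ3.Theorems

end
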